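import Mathlib
import Literature.Probability.Independence.LindebergFellerCLT
import HarnessLib

/-!
# The CLT for uniformly bounded independent summands with divergent variance
# (Durrett 2019, §3.4 Exercise 3.4.10)

Topic `Probability/Independence`; namespace `Literature.Probability.Independence`.  THEOREMS
ONLY: everything is PROVED; no definition, no named fact, no axiom.  "`⇒ χ`" (`χ` standard
normal) is Mathlib's `TendstoInDistribution … Z (fun _ => P) P'` for any `Z` with
`HasLaw Z (gaussianReal 0 1) P'`; `var` is `Var[·; P]`, `E` is `P[·]`.

Source, VERBATIM [cite: Durrett2019, §3.4 Exercises, p. 148 of the held copy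
`book:durrett2019-probability-theory-examples` (PDF p0160)]:
"**3.4.10** Show that if `|X_i| ≤ M` and `Σ_n var(X_n) = ∞`, then
`(S_n − ES_n)/√var(S_n) ⇒ χ`".

FORMALIZATION AND ROUTE.  The independent `X_0, X_1, …` live on one probability space, are
a.e.-measurable with `|X_m| ≤ M` a.s., and `Σ_{m<n} Var X_m → ∞`; `S_n = Σ_{m<n} X_m`.
`Durrett2019_exercise_3_4_10` is the normalised-array form
`Σ_{m<n}(X_m − EX_m)/√(Σ_{m<n} Var X_m) ⇒ N(0,1)`, an immediate specialisation (`K_n = M`,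
`N_n = n`, `K_n²/s_n² → 0` because `s_n² → ∞`) of the tree's corollary
`tendstoInDistribution_sum_sub_div_of_bounded` of the Lindeberg–Feller theorem (Durrett's
Theorem 3.4.10, the intended route: the Lindeberg sum vanishes once `2M < ε s_n`);
`Durrett2019_exercise_3_4_10'` is the printed form with `ES_n = Σ EX_m` and
`var(S_n) = Σ var(X_m)` (`integral_sum_eq_and_variance_sum_eq`, Mathlib's
`IndepFun.variance_sum`).

## References
* R. Durrett, *Probability: Theory and Examples*, 5th ed. (CUP 2019), §3.4, Exercise 3.4.10
  (p. 148); Theorem 3.4.10 (Lindeberg–Feller).  [cite: Durrett2019]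

## Mathlib
`TendstoInDistribution`, `HasLaw`, `IndepFun.variance_sum`, `MemLp.of_bound`.
-/

open MeasureTheory ProbabilityTheory Filter Finset
open scoped Topology NNReal

namespace Literature.Probability.Independence

open _root_.MeasureTheory _root_.ProbabilityTheory

variable {Ω : Type*} {mΩ : MeasurableSpace Ω} {P : Measure Ω} [IsProbabilityMeasure P]
  {X : ℕ → Ω → ℝ} {Ω' : Type*} {mΩ' : MeasurableSpace Ω'} {P' : Measure Ω'}
  [IsProbabilityMeasure P'] {Z : Ω' → ℝ}

/-- **Durrett, Exercise 3.4.10** (normalised-array form). "Show that if `|X_i| ≤ M` and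
`Σ_n var(X_n) = ∞`, then `(S_n − ES_n)/√var(S_n) ⇒ χ`": for independent `X_0, X_1, …` with
`|X_m| ≤ M` a.s. and `Σ_{m<n} Var X_m → ∞`,
`Σ_{m<n}(X_m − EX_m) / √(Σ_{m<n} Var X_m) ⇒ N(0, 1)` — the uniformly-bounded case of the tree's
Lindeberg–Feller corollary `tendstoInDistribution_sum_sub_div_of_bounded`.
[cite: Durrett2019, §3.4 Exercise 3.4.10] -/
theorem Durrett2019_exercise_3_4_10 {M : ℝ} (hXm : ∀ m, AEMeasurable (X m) P)
    (hbound : ∀ m, ∀ᵐ ω ∂P, |X m ω| ≤ M) (hind : iIndepFun X P)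
    (hvar : Tendsto (fun n => ∑ m ∈ range n, Var[X m; P]) atTop atTop)
    (hZ : HasLaw Z (gaussianReal 0 1) P') :
    TendstoInDistribution (fun n ω => (∑ m ∈ range n, (X m ω - P[X m])) /
      √(∑ m ∈ range n, Var[X m; P])) atTop Z (fun _ => P) P' :=
  tendstoInDistribution_sum_sub_div_of_bounded (Ω := fun _ => Ω) (P := fun _ => P)
    (X := fun _ => X) (N := fun n => n) (K := fun _ => M) (fun _ m _ => hXm m)
    (fun _ m _ => hbound m) (fun _ => hind) (hvar.eventually_gt_atTop 0)
    (tendsto_const_nhds.div_atTop hvar) hZ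

/-- `E S_n = Σ_{m<n} E X_m` and `var(S_n) = Σ_{m<n} var(X_m)` for independent bounded `X_m`.
[cite: Durrett2019, §3.4 Exercise 3.4.10 (proof step); Theorem 2.2.1] -/
theorem integral_sum_eq_and_variance_sum_eq {M : ℝ} (hXm : ∀ m, AEMeasurable (X m) P)
    (hbound : ∀ m, ∀ᵐ ω ∂P, |X m ω| ≤ M) (hind : iIndepFun X P) (n : ℕ) :
    P[fun ω => ∑ m ∈ range n, X m ω] = ∑ m ∈ range n, P[X m] ∧
      Var[fun ω => ∑ m ∈ range n, X m ω; P] = ∑ m ∈ range n, Var[X m; P] := by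
  have hL2 : ∀ m, MemLp (X m) 2 P := fun m =>
    MemLp.of_bound (hXm m).aestronglyMeasurable M
      ((hbound m).mono fun ω hω => by simpa [Real.norm_eq_abs] using hω)
  refine ⟨integral_finsetSum _ fun m _ => (hL2 m).integrable one_le_two, ?_⟩
  have h := IndepFun.variance_sum (μ := P) (s := range n) (fun m _ => hL2 m)
    (fun i _ j _ hij => hind.indepFun hij)
  rw [← h]
  congr 1
  funext ω
  simp [Finset.sum_apply]

/-- **Durrett, Exercise 3.4.10** as printed: with `S_n = Σ_{m<n} X_m`,
`(S_n − ES_n)/√var(S_n) ⇒ χ` (standard normal `χ`).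
[cite: Durrett2019, §3.4 Exercise 3.4.10] -/
theorem Durrett2019_exercise_3_4_10' {M : ℝ} (hXm : ∀ m, AEMeasurable (X m) P)
    (hbound : ∀ m, ∀ᵐ ω ∂P, |X m ω| ≤ M) (hind : iIndepFun X P)
    (hvar : Tendsto (fun n => ∑ m ∈ range n, Var[X m; P]) atTop atTop)
    (hZ : HasLaw Z (gaussianReal 0 1) P') :
    TendstoInDistribution (fun n ω => ((∑ m ∈ range n, X m ω) -
        P[fun ω => ∑ m ∈ range n, X m ω]) / √(Var[fun ω => ∑ m ∈ range n, X m ω; P]))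
      atTop Z (fun _ => P) P' := by
  have h := Durrett2019_exercise_3_4_10 hXm hbound hind hvar hZ
  refine ⟨fun n => ?_, hZ.aemeasurable, ?_⟩
  · exact ((Finset.aemeasurable_fun_sum _ fun m _ => hXm m).sub_const _).div_const _
  · convert h.tendsto using 3 with n
    congr 1
    funext ω
    obtain ⟨h1, h2⟩ := integral_sum_eq_and_variance_sum_eq hXm hbound hind n
    rw [h1, h2, Finset.sum_sub_distrib]

end Literature.Probability.Independence
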